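import Summits.NavierStokesRegularity.NavierStokesRegularity.Theorems.PoloidalWindowDoorPoloidalWindowRigidityZShockLoadedCharacteristics
import HarnessLib

/-!
# Crux K2 `PoloidalWindowRigidity` (stmt-NavierStokesRegularity-19708), line `z_shock` — R2 WITHOUT SIGN HYPOTHESIS FOR SOLUTIONS THAT
# SETTLE TO ONE NON-DEGENERATE STATE AT BOTH HEIGHT ENDS `z → ±∞`

`--supports stmt-NavierStokesRegularity-19708 --as helper` (leafhand-ns-poloidalwindowdoor-3 g3, cell decomp-ns, 2026-08-31).  Class-free,
Mathlib + tree files only.  **No stub and no summit is closed by this file; Navier–Stokes regularity is NOT proved here (rung 0).**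

`pSystem_const_of_quiet_heights` — let `(w, p) ∈ C²` solve the autonomous p-system `p_z = −κ(w)² w_x`, `w_z = −p_x` on `ℝ × ℝ`
(two-sided in the height `z`), `κ > 0`, `κ ∈ C¹` nowhere linearly degenerate, `κ(w) ≤ κhi`, `|κ'(w)| ≤ k₁`, `|w_x| ≤ W₁` along the
solution, NO sign hypothesis on `κ'`.  If `w(z, ·) → w∞` UNIFORMLY in `x` both as `z → +∞` and as `z → −∞` (the same value; nothing is
assumed about `p`) and `κ'(w∞) ≠ 0`, then `(w, p)` is constant.  (Companion of `…ZShockQuietInvariant`, p823749, where the quietness is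
at SPATIAL infinity on one slice; there interval filling removes even the condition `κ' ≠ 0` at the limit, here the limit value is the
same `w∞` on every characteristic, so the degenerate case `κ'(w∞) = 0` is exactly what the method cannot see.)

Proof: along any forward characteristic `X`, John's weighted gradient `q` solves `q' = −G(w∘X) q²`
(`…LoadedCharacteristics.johnGradient_hasDerivAt`) and `G(w∘X) → G(w∞) ≠ 0` at both ends; if the characteristic were loaded, `q` would
never vanish (`forwardGradient_ne_zero`) and `…QuietTools.riccati_no_twoSided_of_eventually_pos/neg` would give a contradiction.  So
`p_x + κ(w) w_x ≡ 0` on `ℝ × ℝ` and `…ScalarEternal.pSystem_const_of_forward_flat` finishes. [folklore]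
-/

noncomputable section

namespace Summit.NavierStokesRegularity.NavierStokesRegularity.Theorems.PoloidalWindowDoorPoloidalWindowRigidityZShockQuietHeights

-- the summit and its single sub-problem share the name (CONVENTIONS §1)
set_option linter.dupNamespace false

open Set Filter Topology Function Metric
open Summit.NavierStokesRegularity.NavierStokesRegularity.Theorems.PoloidalWindowDoorPoloidalWindowRigidityZShockScalarEternal
open Summit.NavierStokesRegularity.NavierStokesRegularity.Theorems.PoloidalWindowDoorPoloidalWindowRigidityZShockQuietTools
open Summit.NavierStokesRegularity.NavierStokesRegularity.Theorems.PoloidalWindowDoorPoloidalWindowRigidityZShockLoadedCharacteristics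

variable {w p : ℝ × ℝ → ℝ} {κ κ' K : ℝ → ℝ} {κhi k₁ W₁ winf : ℝ}

/-- **★ R2 without sign hypothesis for height-quiet solutions** (hypotheses and proof in the module docstring). [folklore] -/
theorem pSystem_const_of_quiet_heights (hw : ContDiff ℝ 2 w) (hp : ContDiff ℝ 2 p)
    (hK2 : ContDiff ℝ 2 K) (hKd : ∀ v, HasDerivAt K (κ v) v) (hκd : ∀ v, HasDerivAt κ (κ' v) v) (hκ'c : Continuous κ')
    (hsys1 : ∀ q, fderiv ℝ p q (1, 0) = -(κ (w q) ^ 2 * fderiv ℝ w q (0, 1)))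
    (hsys2 : ∀ q, fderiv ℝ w q (1, 0) = -fderiv ℝ p q (0, 1))
    (hκpos : ∀ v, 0 < κ v) (hκhi : ∀ q, κ (w q) ≤ κhi) (hgn : ∀ a b : ℝ, a < b → ∃ v ∈ Ioo a b, κ' v ≠ 0)
    (hk₁ : ∀ q, |κ' (w q)| ≤ k₁) (hW₁ : ∀ q, |fderiv ℝ w q (0, 1)| ≤ W₁)
    (hTop : ∀ ε > 0, ∃ Z : ℝ, ∀ z x : ℝ, Z ≤ z → |w (z, x) - winf| < ε)
    (hBot : ∀ ε > 0, ∃ Z : ℝ, ∀ z x : ℝ, z ≤ Z → |w (z, x) - winf| < ε)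
    (hne : κ' winf ≠ 0) :
    ∀ q q' : ℝ × ℝ, w q = w q' ∧ p q = p q' := by
  have hw1 : Differentiable ℝ w := hw.differentiable (by simp)
  have hp1 : Differentiable ℝ p := hp.differentiable (by simp)
  have hκc : Continuous κ := continuous_iff_continuousAt.2 fun v => (hκd v).continuousAt
  have hκB : ∀ q, |κ (w q)| ≤ κhi := fun q => by rw [abs_of_pos (hκpos _)]; exact hκhi q
  -- the Riccati coefficient and its value at the limit state
  set G : ℝ → ℝ := fun u => κ' u / (2 * κ u) * Real.exp (-(Real.log (κ u) / 2)) with hG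
  have hGc : ContinuousAt G winf := by
    have hκv : κ winf ≠ 0 := (hκpos winf).ne'
    refine ContinuousAt.mul ?_ ?_
    · exact hκ'c.continuousAt.div (continuousAt_const.mul hκc.continuousAt) (mul_ne_zero two_ne_zero hκv)
    · exact ((hκc.continuousAt.log hκv).div_const 2).neg.rexp
  have hGne : G winf ≠ 0 := by
    simp only [hG]
    exact mul_ne_zero (div_ne_zero hne (mul_ne_zero two_ne_zero (hκpos winf).ne')) (Real.exp_pos _).ne'
  -- every point is unloaded
  have hflat : ∀ q, fderiv ℝ p q (0, 1) + κ (w q) * fderiv ℝ w q (0, 1) = 0 := by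
    rintro ⟨z₀, x₀⟩
    by_contra h0
    obtain ⟨X, hX0, hX⟩ := exists_global_char hw1 hκd hκB hk₁ hW₁ z₀ x₀
    have h0' : fderiv ℝ p (z₀, X z₀) (0, 1) + κ (w (z₀, X z₀)) * fderiv ℝ w (z₀, X z₀) (0, 1) ≠ 0 := by rwa [hX0]
    have hq := johnGradient_hasDerivAt hw hp hK2 hKd hκd hsys1 hsys2 hκpos hX
    have hα := forwardGradient_ne_zero hw hp hK2 hKd hκd hsys1 hsys2 hk₁ hW₁ hX h0'
    have hqne : ∀ z, Real.exp (Real.log (κ (w (z, X z))) / 2) *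
        (fderiv ℝ p (z, X z) (0, 1) + κ (w (z, X z)) * fderiv ℝ w (z, X z) (0, 1)) ≠ 0 :=
      fun z => mul_ne_zero (Real.exp_pos _).ne' (hα z)
    -- `w ∘ X → winf` at both ends
    have hwTop : Tendsto (fun z => w (z, X z)) atTop (𝓝 winf) := by
      rw [Metric.tendsto_atTop]
      intro ε hε
      obtain ⟨Z, hZ⟩ := hTop ε hε
      exact ⟨Z, fun z hz => by rw [Real.dist_eq]; exact hZ z (X z) hz⟩
    have hwBot : Tendsto (fun z => w (z, X z)) atBot (𝓝 winf) := by
      rw [tendsto_order]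
      constructor
      · intro a ha
        obtain ⟨Z, hZ⟩ := hBot (winf - a) (by linarith)
        refine eventually_atBot.2 ⟨Z, fun z hz => ?_⟩
        have h := hZ z (X z) hz
        rw [abs_lt] at h; linarith [h.1]
      · intro a ha
        obtain ⟨Z, hZ⟩ := hBot (a - winf) (by linarith)
        refine eventually_atBot.2 ⟨Z, fun z hz => ?_⟩
        have h := hZ z (X z) hz
        rw [abs_lt] at h; linarith [h.2]
    have hGtop : Tendsto (fun z => G (w (z, X z))) atTop (𝓝 (G winf)) := hGc.tendsto.comp hwTop
    have hGbot : Tendsto (fun z => G (w (z, X z))) atBot (𝓝 (G winf)) := hGc.tendsto.comp hwBot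
    rcases lt_or_gt_of_ne hGne with hneg | hpos
    · have hlt : G winf < G winf / 2 := by linarith
      obtain ⟨T, hT⟩ := eventually_atTop.1 (hGtop.eventually_lt_const hlt)
      obtain ⟨S, hS⟩ := eventually_atBot.1 (hGbot.eventually_lt_const hlt)
      exact riccati_no_twoSided_of_eventually_neg (b₀ := -(G winf / 2)) hq hqne (by linarith)
        (fun z hz => by linarith [hT z hz]) (fun z hz => by linarith [hS z hz])
    · have hlt : G winf / 2 < G winf := by linarith
      obtain ⟨T, hT⟩ := eventually_atTop.1 (hGtop.eventually_const_lt hlt)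
      obtain ⟨S, hS⟩ := eventually_atBot.1 (hGbot.eventually_const_lt hlt)
      exact riccati_no_twoSided_of_eventually_pos (b₀ := G winf / 2) hq hqne (by linarith)
        (fun z hz => (hT z hz).le) (fun z hz => (hS z hz).le)
  exact pSystem_const_of_forward_flat hw1 hp1 hκd hsys1 hsys2 hκpos hκhi hk₁ hW₁ hgn hflat

end Summit.NavierStokesRegularity.NavierStokesRegularity.Theorems.PoloidalWindowDoorPoloidalWindowRigidityZShockQuietHeights

end
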